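import Mathlib
import Summits.MatrixMultiplication.MatrixMultiplication.Theses.FourierTwoFamiliesModP

/-!
# `PrimeTwoFamilies → cyclic ladders` — stub `cyclicLadder_of_primeTwoFamilies` (siege k4: certificate on the finite core)

Crux `PrimeTwoFamilies` (stmt-MatrixMultiplication-14308, route `FourierTwoFamiliesModP`; CKSU 2005
Conj. 4.7 with prime cyclic hosts).  Line `Sketch` reads the crux through the CYCLIC LADDER CONJECTURE:
for every `ε > 0` and arbitrarily large `m`, an ordered escape ladder in `ℤ/m` — (i) every class
`X c ⊕ Y c` direct; (ii) for classes `p < q`, every lower cross difference `y' - x'` (`x' ∈ X p`,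
`y' ∈ Y q`) avoids every diagonal difference `y - x` (`x ∈ X c`, `y ∈ Y c`) — with `r ≥ m^{1/2-ε}`
classes of co-volume `|X c| |Y c| ≥ m^{1-ε}`.

This file proves the registered stub `cyclicLadder_of_primeTwoFamilies` (crux ⇒ ladders).  The proof is
organised around the FINITE CORE as a certificate transfer, kept separate from the asymptotics:

* `ladderCertificate_of_sdpp` — in any additive commutative group, an SDPP certificate `(A i, B i)_{i<n}`
  read verbatim, `(X, Y) := (A, B)`, is a ladder certificate: (W) is (i) literally and clause (X) at the
  index triple `(p, c, q)` is clause (ii).  No counting, no choice: the SDPP witness IS the ladder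
  certificate.
* `sq_card_certificate` — the only counting fact needed to certify `m ≥ m₀` is the trivial packing
  `|A| |B| ≤ p²` of two subsets of `ℤ/p` (no injectivity argument): with `n₀ := m₀² + 1` it gives
  `m₀² < n ≤ n^{2-δ} ≤ |A₀| |B₀| ≤ p²`, hence `m₀ < p`.
* `log_bookkeeping` + `rpow_le_rpow_of_log_mul_le` — the exponents are done LOG-LINEARLY: with
  `P := log p`, `N := log n ≥ 0` the hypothesis `p ≤ n^{2+δ}` is `P ≤ (2+δ) N`, and for `δ := min ε 1`
  the two targets `p^{1/2-ε} ≤ n`, `p^{1-ε} ≤ n^{2-δ}` are the linear facts `(1/2-ε) P ≤ N`,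
  `(1-ε) P ≤ (2-δ) N`.

(`decide` proper has no target here: every finite parameter of the stub — `m`, `r`, the sets — is
universally quantified through `hT`; the finite core is therefore certified structurally, once, for all
instances.)  Independent proofs of the same registered statement: `…LadderLift.cyclicLadder_of_primeTwoFamilies`
(via `p^{1/(2+δ)} ≤ n`) and `…SiegeK17.cyclicLadder_of_primeTwoFamilies` (base monotonicity of `rpow`).
-/

-- single-conjunct summit: the mandated namespace repeats `MatrixMultiplication` (summit = sub-problem).
set_option linter.dupNamespace false

namespace Summit.MatrixMultiplication.MatrixMultiplication.Theorems.PrimeTwoFamilies.SiegeK4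

open Finset
open Summit.MatrixMultiplication.MatrixMultiplication.Theses

/-! ## The finite core: an SDPP witness is a ladder certificate -/

/-- **Finite core (certificate transfer).**  In any additive commutative group, an SDPP certificate
`(A i, B i)_{i<n}` — (W) every `A i ⊕ B i` direct, (X) the cross clause
`(a - a') + (b - b') = 0, a ∈ A i, a' ∈ A j, b ∈ B j, b' ∈ B k ⟹ i = k` — is, read verbatim, a
ladder certificate: (i) is (W) literally, and the one-directional clause (ii) — for `p < q` no lower
cross difference `y' - x'` (`x' ∈ A p`, `y' ∈ B q`) equals a diagonal difference `y - x`
(`x ∈ A c`, `y ∈ B c`) — is clause (X) at the index triple `(i, j, k) = (p, c, q)`, because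
`y - x = y' - x'` says `(x' - x) + (y - y') = 0`. -/
theorem ladderCertificate_of_sdpp {G : Type*} [AddCommGroup G] {n : ℕ} (A B : Fin n → Finset G)
    (hW : ∀ i : Fin n, ∀ a ∈ A i, ∀ a' ∈ A i, ∀ b ∈ B i, ∀ b' ∈ B i,
      (a - a') + (b - b') = 0 → a = a' ∧ b = b')
    (hX : ∀ i j k : Fin n, ∀ a ∈ A i, ∀ a' ∈ A j, ∀ b ∈ B j, ∀ b' ∈ B k,
      (a - a') + (b - b') = 0 → i = k) :
    (∀ c : Fin n, ∀ x ∈ A c, ∀ x' ∈ A c, ∀ y ∈ B c, ∀ y' ∈ B c,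
        (x - x') + (y - y') = 0 → x = x' ∧ y = y') ∧
      (∀ c p q : Fin n, p < q → ∀ x ∈ A c, ∀ y ∈ B c, ∀ x' ∈ A p, ∀ y' ∈ B q,
        y - x ≠ y' - x') := by
  refine ⟨hW, fun c p q hpq x hx y hy x' hx' y' hy' h => ?_⟩
  have h0 : (x' - x) + (y - y') = (y - x) - (y' - x') := by abel
  rw [h, sub_self] at h0
  exact absurd (hX p c q x' hx' x hx y hy y' hy' h0) (ne_of_lt hpq)

/-- **Packing certificate (trivial form).**  For subsets `A, B ⊆ ℤ/p` one has `|A| |B| ≤ p²`; hence a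
real lower bound `L ≤ |A| |B|` certifies `L ≤ p²`. -/
theorem sq_card_certificate {p : ℕ} [NeZero p] (A B : Finset (ZMod p)) {L : ℝ}
    (hL : L ≤ ((A.card * B.card : ℕ) : ℝ)) : L ≤ (p : ℝ) ^ 2 := by
  have hA : A.card ≤ p := (card_le_univ A).trans_eq (ZMod.card p)
  have hB : B.card ≤ p := (card_le_univ B).trans_eq (ZMod.card p)
  have hAB : ((A.card * B.card : ℕ) : ℝ) ≤ (p : ℝ) ^ 2 := by
    rw [sq]
    exact_mod_cast Nat.mul_le_mul hA hB
  exact hL.trans hAB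

/-! ## Log-linear exponent bookkeeping -/

/-- Comparison of real powers through logarithms: for `0 < x`, `0 < y`,
`a · log x ≤ b · log y ⟹ x^a ≤ y^b`. -/
theorem rpow_le_rpow_of_log_mul_le {x y a b : ℝ} (hx : 0 < x) (hy : 0 < y)
    (h : a * Real.log x ≤ b * Real.log y) : x ^ a ≤ y ^ b := by
  rw [← Real.log_le_log_iff (Real.rpow_pos_of_pos hx a) (Real.rpow_pos_of_pos hy b),
    Real.log_rpow hx, Real.log_rpow hy]
  exact h

/-- The two linear inequalities behind the exponents: if `0 < δ ≤ ε`, `δ ≤ 1`, `0 ≤ P`, `0 ≤ N` and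
`P ≤ (2 + δ) N`, then `(1/2 - ε) P ≤ 1 · N` and `(1 - ε) P ≤ (2 - δ) N`
(for a nonnegative coefficient multiply `P ≤ (2+δ)N` and use `(2+δ)(1/2-ε) ≤ 1`,
`(2+δ)(1-ε) ≤ 2-δ`; for a negative coefficient the left side is `≤ 0 ≤` the right side). -/
theorem log_bookkeeping {ε δ P N : ℝ} (hε : 0 < ε) (hδ : 0 < δ) (hδε : δ ≤ ε) (hδ1 : δ ≤ 1)
    (hP : 0 ≤ P) (hN : 0 ≤ N) (hPN : P ≤ (2 + δ) * N) :
    (1 / 2 - ε) * P ≤ 1 * N ∧ (1 - ε) * P ≤ (2 - δ) * N := by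
  have hεδ : 0 < ε * δ := mul_pos hε hδ
  refine ⟨?_, ?_⟩
  · rcases le_or_gt 0 (1 / 2 - ε) with h | h
    · have hc : (1 / 2 - ε) * (2 + δ) - 1 ≤ 0 := by linarith
      calc (1 / 2 - ε) * P ≤ (1 / 2 - ε) * ((2 + δ) * N) := mul_le_mul_of_nonneg_left hPN h
        _ = 1 * N + ((1 / 2 - ε) * (2 + δ) - 1) * N := by ring
        _ ≤ 1 * N := by nlinarith [mul_nonpos_of_nonpos_of_nonneg hc hN]
    · nlinarith [mul_nonpos_of_nonpos_of_nonneg h.le hP]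
  · rcases le_or_gt 0 (1 - ε) with h | h
    · have hc : (1 - ε) * (2 + δ) - (2 - δ) ≤ 0 := by linarith
      calc (1 - ε) * P ≤ (1 - ε) * ((2 + δ) * N) := mul_le_mul_of_nonneg_left hPN h
        _ = (2 - δ) * N + ((1 - ε) * (2 + δ) - (2 - δ)) * N := by ring
        _ ≤ (2 - δ) * N := by nlinarith [mul_nonpos_of_nonpos_of_nonneg hc hN]
    · have h1 : (1 - ε) * P ≤ 0 := mul_nonpos_of_nonpos_of_nonneg h.le hP
      have h2 : 0 ≤ (2 - δ) * N := mul_nonneg (by linarith) hN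
      linarith

/-! ## The stub -/

/-- **Stub `cyclicLadder_of_primeTwoFamilies`** (crux ⇒ cyclic ladder conjecture, clauses inlined):
`PrimeTwoFamilies` gives, for every `ε > 0` and `m₀`, a modulus `m ≥ m₀` and `r ≥ m^{1/2-ε}` ladder
classes `(X c, Y c)` in `ℤ/m` — (i) each `X c ⊕ Y c` direct, (ii) lower cross differences of classes
`p < q` avoid all diagonal differences — of co-volume `|X c| |Y c| ≥ m^{1-ε}`.
Proof: apply the crux at the slice `δ := min ε 1` beyond `n₀ := m₀² + 1`; the SDPP witness
`(A, B)` in `ℤ/p` is the certificate, with `m := p`, `r := n`, `(X, Y) := (A, B)`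
(`ladderCertificate_of_sdpp`); `m₀ < p` by `sq_card_certificate`; the exponents by `log_bookkeeping`. -/
theorem cyclicLadder_of_primeTwoFamilies (hT : FourierTwoFamiliesModP.PrimeTwoFamilies) :
    ∀ ε : ℝ, 0 < ε → ∀ m₀ : ℕ, ∃ m ≥ m₀, ∃ r : ℕ, ∃ X Y : Fin r → Finset (ZMod m),
      ((∀ c : Fin r, ∀ x ∈ X c, ∀ x' ∈ X c, ∀ y ∈ Y c, ∀ y' ∈ Y c,
          (x - x') + (y - y') = 0 → x = x' ∧ y = y') ∧
        (∀ c p q : Fin r, p < q → ∀ x ∈ X c, ∀ y ∈ Y c, ∀ x' ∈ X p, ∀ y' ∈ Y q,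
          y - x ≠ y' - x')) ∧
      (m : ℝ) ^ (1 / 2 - ε) ≤ (r : ℝ) ∧
      ∀ c : Fin r, (m : ℝ) ^ (1 - ε) ≤ (((X c).card * (Y c).card : ℕ) : ℝ) := by
  intro ε hε m₀
  have hδ : 0 < min ε 1 := lt_min hε one_pos
  have hδε : min ε 1 ≤ ε := min_le_left ε 1
  have hδ1 : min ε 1 ≤ 1 := min_le_right ε 1
  generalize min ε 1 = δ at hδ hδε hδ1
  obtain ⟨n, hn, p, hp, A, B, hW, hX, hpn, hAB⟩ := hT δ hδ (m₀ ^ 2 + 1)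
  haveI : Fact p.Prime := ⟨hp⟩
  -- positivity of the two bases
  have hn1 : 1 ≤ n := le_trans (Nat.le_add_left 1 (m₀ ^ 2)) hn
  have hn1' : (1 : ℝ) ≤ n := by exact_mod_cast hn1
  have hn0 : (0 : ℝ) < n := one_pos.trans_le hn1'
  have hp1' : (1 : ℝ) ≤ p := by exact_mod_cast hp.one_lt.le
  have hp0 : (0 : ℝ) < p := one_pos.trans_le hp1'
  -- `n ≤ n^{2-δ}` (base ≥ 1, exponent ≥ 1)
  have hn_le : (n : ℝ) ≤ (n : ℝ) ^ (2 - δ) := by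
    calc (n : ℝ) = (n : ℝ) ^ (1 : ℝ) := (Real.rpow_one _).symm
      _ ≤ (n : ℝ) ^ (2 - δ) := Real.rpow_le_rpow_of_exponent_le hn1' (by linarith)
  -- the logarithms
  have hN : 0 ≤ Real.log n := Real.log_nonneg hn1'
  have hP : 0 ≤ Real.log p := Real.log_nonneg hp1'
  have hPN : Real.log p ≤ (2 + δ) * Real.log n := by
    have h := Real.log_le_log hp0 hpn
    rwa [Real.log_rpow hn0] at h
  obtain ⟨h₁, h₂⟩ := log_bookkeeping hε hδ hδε hδ1 hP hN hPN
  refine ⟨p, ?_, n, A, B, ladderCertificate_of_sdpp A B hW hX, ?_, fun c => ?_⟩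
  · -- `m₀ ≤ p`: `m₀² < n ≤ n^{2-δ} ≤ |A i₀| |B i₀| ≤ p²`
    have hsq : (n : ℝ) ≤ (p : ℝ) ^ 2 :=
      sq_card_certificate (A ⟨0, hn1⟩) (B ⟨0, hn1⟩) (hn_le.trans (hAB ⟨0, hn1⟩))
    have hlt : ((m₀ ^ 2 : ℕ) : ℝ) < n := by exact_mod_cast hn
    have hm0 : (0 : ℝ) ≤ m₀ := Nat.cast_nonneg m₀
    have hlt' : (m₀ : ℝ) < p := by
      push_cast at hlt
      nlinarith
    exact_mod_cast hlt'.le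
  · -- `p^{1/2-ε} ≤ n`
    exact (rpow_le_rpow_of_log_mul_le hp0 hn0 h₁).trans_eq (Real.rpow_one _)
  · -- `p^{1-ε} ≤ n^{2-δ} ≤ |A c| |B c|`
    exact (rpow_le_rpow_of_log_mul_le hp0 hn0 h₂).trans (hAB c)

end Summit.MatrixMultiplication.MatrixMultiplication.Theorems.PrimeTwoFamilies.SiegeK4
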